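import Mathlib.MeasureTheory.Integral.IntegralEqImproper
import Mathlib.Analysis.Calculus.ContDiff.Deriv
import Mathlib.Analysis.SpecialFunctions.Pow.Deriv
import Mathlib.Tactic
import HarnessLib

/-!
# First lemma `QuadrupoleMomentIdentity` of the crux idea «reynolds-quadrupole-threading» (ns-idea-15; crux
# `PoloidalLiouville`, stmt-NavierStokesRegularity-1222, W1) — kernel proof by integration by parts

Support file for crux `PoloidalLiouville` (line «reynolds-quadrupole-threading» of planner ns-idea-15 g0,
`Cruxes/PoloidalLiouville/ReynoldsQuadrupoleSketch.lean` :109 «FIRST LEMMA (provable now, S–M; integration by parts,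
sympy-certified)»; verdicts idea-crit-8 V52 / ns-wall-crit-1 V2 PASS-WITH-PRICE).  Experiment cell ARM A
`pub/ns-exp-scalarLiouville` (D-0160), generation g3.  One-variable calculus only; nothing here bears on `PoloidalLiouville`
/ NS regularity.

* `ReynoldsQuadrupole.quadrupoleMomentIdentity` — the body of the sketch's `QuadrupoleMomentIdentity` VERBATIM, with the
  sketch's `quadSource h t = 8(18 h h′ + 3 t h h″ + 2 t h′² − t² h′ h″)/(7t)` delta-unfolded:
  `U₂(R) := ∫₀^R t⁶ s₂[h] → (20/7) ∫₀^∞ t⁶ h′²` as `R → ∞`, for `h ∈ C²` with `t⁶h′² ∈ L¹(0,∞)`, `t⁶ h h′ → 0`,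
  `t⁷ h′² → 0`.

PROOF.  `t⁶ s₂[h](t) = (8/7) t⁵ (18 h h′ + 3 t h h″ + 2 t h′² − t² h′ h″)` for all `t` (also at `t = 0`, where both
sides vanish under Lean's `x/0 = 0`), and `(7/8)·t⁶ s₂[h] = d/dt[3 t⁶ h h′ − ½ t⁷ h′²] + (5/2) t⁶ h′²`; so by the
fundamental theorem of calculus `U₂(R) = (8/7)(3R⁶h(R)h′(R) − ½R⁷h′(R)²) + (20/7)∫₀^R t⁶h′²`, and the boundary terms
tend to `0` while `∫₀^R t⁶h′² → ∫₀^∞ t⁶h′²` (`intervalIntegral_tendsto_integral_Ioi`).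
-/

-- the summit and its single problem share the name (D-0017 nested layout)
set_option linter.dupNamespace false

noncomputable section

namespace Summit.NavierStokesRegularity.NavierStokesRegularity.Theorems.PoloidalLiouville.ReynoldsQuadrupole

open Filter Set MeasureTheory Topology

/-- The integrand `t⁶ s₂[h](t)` is the polynomial expression `(8/7) t⁵ (18 h h′ + 3 t h h″ + 2 t h′² − t² h′ h″)`
(for `t ≠ 0` by clearing the denominator `7t`; at `t = 0` both sides are `0`). -/
theorem pow_six_mul_quadSource (h : ℝ → ℝ) (t : ℝ) :
    t ^ 6 * (8 * (18 * h t * deriv h t + 3 * h t * deriv (deriv h) t * t + 2 * (deriv h t) ^ 2 * t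
      - deriv h t * deriv (deriv h) t * t ^ 2) / (7 * t))
    = 8 / 7 * t ^ 5 * (18 * h t * deriv h t + 3 * h t * deriv (deriv h) t * t + 2 * (deriv h t) ^ 2 * t
      - deriv h t * deriv (deriv h) t * t ^ 2) := by
  rcases eq_or_ne t 0 with rfl | ht
  · simp
  · field_simp

/-- **`QuadrupoleMomentIdentity`** (first lemma of «reynolds-quadrupole-threading», VERBATIM body with `quadSource`
unfolded): for `h ∈ C²(ℝ)` with `∫₀^∞ t⁶ h′(t)² dt < ∞`, `t⁶ h(t) h′(t) → 0` and `t⁷ h′(t)² → 0` as `t → ∞`,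
`∫₀^R t⁶ s₂[h](t) dt → (20/7) ∫₀^∞ t⁶ h′(t)² dt` — the quadrupole moment of the shell's pressure source is `(20/7)`
times a manifestly nonnegative radial factor (positive unless `h′ ≡ 0` on `(0,∞)`). -/
theorem quadrupoleMomentIdentity :
    ∀ h : ℝ → ℝ, ContDiff ℝ 2 h →
    IntegrableOn (fun t : ℝ => t ^ 6 * (deriv h t) ^ 2) (Set.Ioi 0) →
    Tendsto (fun t : ℝ => t ^ 6 * h t * deriv h t) atTop (𝓝 0) →
    Tendsto (fun t : ℝ => t ^ 7 * (deriv h t) ^ 2) atTop (𝓝 0) →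
    Tendsto (fun R : ℝ => ∫ t in (0 : ℝ)..R, t ^ 6 *
        (8 * (18 * h t * deriv h t + 3 * h t * deriv (deriv h) t * t + 2 * (deriv h t) ^ 2 * t
          - deriv h t * deriv (deriv h) t * t ^ 2) / (7 * t))) atTop
      (𝓝 (20 / 7 * ∫ t in Set.Ioi 0, t ^ 6 * (deriv h t) ^ 2)) := by
  intro h hh hint hb1 hb2
  -- ### derivatives and continuity of `h`, `h′`, `h″`
  have hh' : ContDiff ℝ (1 + 1) h := by rw [one_add_one_eq_two]; exact hh
  have hC1 : ContDiff ℝ 1 (deriv h) := (contDiff_succ_iff_deriv.mp hh').2.2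
  have hd1 : ∀ t, HasDerivAt h (deriv h t) t := fun t =>
    ((hh.differentiable (by norm_num)) t).hasDerivAt
  have hd2 : ∀ t, HasDerivAt (deriv h) (deriv (deriv h) t) t := fun t =>
    ((hC1.differentiable (by norm_num)) t).hasDerivAt
  have hc0 : Continuous h := hh.continuous
  have hc1 : Continuous (deriv h) := hC1.continuous
  have hc2 : Continuous (deriv (deriv h)) := hC1.continuous_deriv le_rfl
  -- ### the integrand in polynomial form, and its continuity
  set f : ℝ → ℝ := fun t => 8 / 7 * t ^ 5 * (18 * h t * deriv h t + 3 * h t * deriv (deriv h) t * t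
      + 2 * (deriv h t) ^ 2 * t - deriv h t * deriv (deriv h) t * t ^ 2) with hf
  have hfeq : (fun t : ℝ => t ^ 6 *
        (8 * (18 * h t * deriv h t + 3 * h t * deriv (deriv h) t * t + 2 * (deriv h t) ^ 2 * t
          - deriv h t * deriv (deriv h) t * t ^ 2) / (7 * t))) = f := by
    funext t; rw [hf]; exact pow_six_mul_quadSource h t
  have hfc : Continuous f := by
    rw [hf]; fun_prop
  have hgc : Continuous fun t : ℝ => t ^ 6 * (deriv h t) ^ 2 := by fun_prop
  -- ### the primitive `G` of `f − (20/7) t⁶ h′²`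
  set G : ℝ → ℝ := fun t => 8 / 7 * (3 * (t ^ 6 * h t * deriv h t) - 1 / 2 * (t ^ 7 * (deriv h t) ^ 2))
    with hG
  have hGd : ∀ t, HasDerivAt G (f t - 20 / 7 * (t ^ 6 * (deriv h t) ^ 2)) t := by
    intro t
    have e1 := ((hasDerivAt_pow 6 t).mul (hd1 t)).mul (hd2 t)
    have e2 := (hasDerivAt_pow 7 t).mul ((hd2 t).pow 2)
    have e3 := ((e1.const_mul (3 : ℝ)).sub (e2.const_mul (1 / 2 : ℝ))).const_mul (8 / 7 : ℝ)
    have e4 := e3.congr_deriv (show _ = f t - 20 / 7 * (t ^ 6 * (deriv h t) ^ 2) by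
      rw [hf]; simp only [Pi.mul_apply, Pi.pow_apply]; push_cast; ring)
    exact e4
  -- ### FTC on `[0, R]`: `∫₀^R f = G R + (20/7) ∫₀^R t⁶ h′²`
  have hG0 : G 0 = 0 := by rw [hG]; norm_num
  have hftc : ∀ R : ℝ, ∫ t in (0 : ℝ)..R, f t = G R + 20 / 7 * ∫ t in (0 : ℝ)..R, t ^ 6 * (deriv h t) ^ 2 := by
    intro R
    have hi1 : IntervalIntegrable f volume 0 R := hfc.intervalIntegrable _ _
    have hi2 : IntervalIntegrable (fun t : ℝ => t ^ 6 * (deriv h t) ^ 2) volume 0 R := hgc.intervalIntegrable _ _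
    have h1 : ∫ t in (0 : ℝ)..R, (f t - 20 / 7 * (t ^ 6 * (deriv h t) ^ 2)) = G R - G 0 :=
      intervalIntegral.integral_eq_sub_of_hasDerivAt (fun t _ => hGd t)
        (hi1.sub (hi2.const_mul (20 / 7)))
    rw [intervalIntegral.integral_sub hi1 (hi2.const_mul (20 / 7)), intervalIntegral.integral_const_mul, hG0,
      sub_zero] at h1
    linarith
  -- ### the limit
  have hGlim : Tendsto G atTop (𝓝 0) := by
    have := ((hb1.const_mul 3).sub (hb2.const_mul (1 / 2))).const_mul (8 / 7)
    rw [hG]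
    convert this using 2
    norm_num
  have hIlim : Tendsto (fun R : ℝ => ∫ t in (0 : ℝ)..R, t ^ 6 * (deriv h t) ^ 2) atTop
      (𝓝 (∫ t in Set.Ioi 0, t ^ 6 * (deriv h t) ^ 2)) :=
    MeasureTheory.intervalIntegral_tendsto_integral_Ioi 0 hint tendsto_id
  have hsum := hGlim.add (hIlim.const_mul (20 / 7))
  rw [zero_add] at hsum
  rw [hfeq]
  exact hsum.congr fun R => (hftc R).symm

end Summit.NavierStokesRegularity.NavierStokesRegularity.Theorems.PoloidalLiouville.ReynoldsQuadrupole

end
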